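/-
Origin: expansion seat `planner-pub-hodgecm-pv14-g5-0`, handover import Pv14g5.WeilThetaModelHeisenbergRelations -> HodgeCM.Automorphic.WeilThetaModelHeisenbergRelations ; Mathlib.GroupTheory.CoprodI + Mathlib.GroupTheory.FreeGroup.CyclicallyReduced unchanged ; after WeilThetaModelHeisenbergRelations (#13); independent of #14 (`HOME/pub-hodgecm-pv14-g5/lean/Pv14g5/WeilThetaModelHeisenbergPresentation.lean`, md5 2da8efc0, 481 lines);
landed by the gen-8 packager in gate run 29 as `HodgeCM/Automorphic/WeilThetaModelHeisenbergPresentation.lean` (import ^import Pv14g5\.WeilThetaModelHeisenbergRelations[ \t]*$→import HodgeCM.Automorphic.WeilThetaModelHeisenbergRelations ×1).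
-/
/-
Copyright (c) 2026. All rights reserved.
Released under Apache 2.0 license as described in the file LICENSE.
-/
import Summits.HodgeConjecture.HodgeCM.Automorphic.WeilThetaModelHeisenbergRelations
import Mathlib.GroupTheory.CoprodI
import Mathlib.GroupTheory.FreeGroup.CyclicallyReduced

/-!
# `⟨S_m, U⟩` is presented by `σ⁴ = 1`, `[σ², u] = 1`: `ker ψ = ⟪σ⁴, [σ², u]⟫`, and NO cocycle on `⟨S_m, U⟩`

Files #12–#13 made the free group `F⟨σ,u⟩` act on `Heis V` (`ψ`: `σ ↦ S_m = weylAut m`, `u ↦ U = u_2`) and on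
`𝓢(V, ℂ)` (`π`: `σ ↦ 𝓕`, `u ↦ T_m`), and proved `⟪σ⁴, [σ², u]⟫ ≤ ker π ⊓ ker ψ`.  Here we prove the converse
inclusion on the Heisenberg side, for every level `m ≠ 0` and every nontrivial `V`:

* `Heis.ker_psAction_eq_psRelations : ker ψ = ⟪σ⁴, [σ², u]⟫` — i.e. the matrix group
  `⟨S_m, U⟩ ≤ Sp(V ⊕ V)`, `S_m = (0 m; -m⁻¹ 0)`, `U = (1 0; 2 1)`, is PRESENTED by the two relations
  `S_m⁴ = 1`, `[S_m², U] = 1` (so `⟨S_m, U⟩ ≅ F₂ ⋊ C₄`: `⟨S_m⟩ ≅ C₄` acting on the free group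
  `⟨U, S_m U S_m⁻¹⟩ ≅ F₂` through the swap of its two generators; `psQuotEquivRange`);
* consequently (§ 5) EVERY relation of `⟨S_m, U⟩` holds ON THE
  NOSE in `U(𝓢(V, ℂ))`: `ψ w = 1 → π w = 1` (`psRep_eq_one_of_psAction_eq_one`), so `ker ψ ≤ ker π`, the
  representation `π` DESCENDS to a genuine (not projective) representation of `⟨S_m, U⟩ = F⟨σ,u⟩ / ker ψ`, and the
  model `repP` of #12 factors through `Heis V ⋊ ⟨S_m, U⟩` (`repP_inr_eq_of_psAction_eq`).  In Weil's language:
  the restriction of the metaplectic cocycle to the subgroup `⟨S_m, U⟩` is trivialised by the section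
  `S_m ↦ 𝓕`, `U ↦ T_m` — for every `m ≠ 0`, in every dimension.

## Proof

1. (`injective_lift_of_zpow_ping_pong`) a "powers" form of the ping-pong lemma for free groups, reduced to
   Mathlib's `Monoid.CoprodI.lift_injective_of_ping_pong` exactly as Mathlib reduces
   `FreeGroup.injective_lift_of_ping_pong`.
2. (`Heis.injective_lift_pairGen`) the pair `x = U = u_2 : (a, b) ↦ (a, b + 2a)`, `y = S_m U S_m⁻¹ : (a, b) ↦
   (a - 2m² b, b)` plays ping-pong on `Heis V` with the cones `{‖a‖ < ‖b‖}`, `{‖b‖ < ‖a‖}` (`2 · 2m² ≥ 4`), so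
   `⟨x, y⟩ ≤ MulAut (Heis V)` is free on `x, y`.
3. (`exists_normalForm`) in `Q = F⟨σ,u⟩ / ⟪σ⁴, [σ², u]⟫` every element is `s^ε · Φ(v)` with `s` the class of `σ`
   and `Φ : F⟨x,y⟩ → Q`, `x ↦ u`, `y ↦ σ u σ⁻¹` (conjugation by `s` swaps `x ↔ y` modulo the relations).
4. If `ψ w = 1`, write `w ≡ σ^ε Φ(v)`; then `S_m^ε = L(v)⁻¹` with `L = ψ ∘ Φ` injective (step 2); raising to the
   fourth power and using torsion-freeness of `F⟨x,y⟩` gives `v = 1`, then `S_m^ε = 1` forces `4 ∣ ε`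
   (`S_m, S_m², S_m³ ≠ 1` on a nontrivial `V`), so `w ∈ ⟪σ⁴, [σ², u]⟫`.

References: the ping-pong lemma (Lyndon–Schupp, Combinatorial Group Theory, § III.12; here via Mathlib's
`Monoid.CoprodI.lift_injective_of_ping_pong`); [We64] nos. 13–14 for the cocycle this makes trivial on `⟨S_m, U⟩`.
-/

set_option autoImplicit false

noncomputable section

open scoped Pointwise RealInnerProductSpace SchwartzMap

namespace HodgeCM
namespace SchwartzWeil

/-! ## 1. Ping-pong for powers of the generators -/

section PingPong

open Cardinal
open scoped Function

variable {ι : Type*} [Nontrivial ι] {G : Type*} [Group G] (a : ι → G) {α : Type*} [MulAction G α]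
  (X : ι → Set α)

/-- **Ping-pong lemma, cyclic-subgroups form.**  If the generators `a i` act on a set with pairwise disjoint
non-empty "cones" `X i` such that every non-zero power of `a i` maps every other cone into `X i`, then
`FreeGroup.lift a` is injective (the `a i` freely generate a free subgroup).  (Reduction to
`Monoid.CoprodI.lift_injective_of_ping_pong`, following Mathlib's `FreeGroup.injective_lift_of_ping_pong`.) -/
theorem injective_lift_of_zpow_ping_pong (hXnonempty : ∀ i, (X i).Nonempty)
    (hXdisj : Pairwise (Disjoint on X))
    (hpp : Pairwise fun i j => ∀ n : ℤ, n ≠ 0 → a i ^ n • X j ⊆ X i) :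
    Function.Injective (FreeGroup.lift a) := by
  classical
  have h1 : FreeGroup.lift a =
      (Monoid.CoprodI.lift fun i => FreeGroup.lift fun _ => a i).comp
        (@freeGroupEquivCoprodI ι).toMonoidHom := by
    ext i
    simp
  rw [h1, MonoidHom.coe_comp]
  refine Function.Injective.comp ?_ (MulEquiv.injective freeGroupEquivCoprodI)
  change Function.Injective (Monoid.CoprodI.lift fun i : ι => FreeGroup.lift fun _ => a i)
  let H : ι → Type _ := fun _ => FreeGroup Unit
  let f : ∀ i, H i →* G := fun i => FreeGroup.lift fun _ => a i
  apply Monoid.CoprodI.lift_injective_of_ping_pong f _ X hXnonempty hXdisj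
  · change Pairwise fun i j => ∀ h : H i, h ≠ 1 → f i h • X j ⊆ X i
    rintro i j hij
    refine FreeGroup.freeGroupUnitEquivInt.forall_congr_left.mpr ?_
    intro n hne1
    change FreeGroup.lift (fun _ => a i) (FreeGroup.of () ^ n) • X j ⊆ X i
    simp only [map_zpow, FreeGroup.lift_apply_of]
    have hnne0 : n ≠ 0 := by
      rintro rfl
      apply hne1
      simp [H, FreeGroup.freeGroupUnitEquivInt]
    exact hpp hij n hnne0
  · show _ ∨ ∃ i, 3 ≤ #(H i)
    inhabit ι
    right
    use Inhabited.default
    simp only [H]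
    rw [FreeGroup.freeGroupUnitEquivInt.cardinal_eq, Cardinal.mk_denumerable]
    exact natCast_le_aleph0

end PingPong

/-! ## 2. The ping-pong pair `U = u_2`, `S_m U S_m⁻¹` in `MulAut (Heis V)` -/

namespace Heis

variable {V : Type*} [NormedAddCommGroup V] [InnerProductSpace ℝ V] (m : ℤ) (hm : m ≠ 0)

/-- `(u_2)ⁿ = u_{2n}`. -/
theorem unip_two_zpow (n : ℤ) : (unip 2 : MulAut (Heis V)) ^ n = unip (2 * (n : ℝ)) := by
  induction n using Int.induction_on with
  | zero => rw [zpow_zero, Int.cast_zero, mul_zero, unip_zero]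
  | succ k ih => rw [zpow_add_one, ih, Int.cast_add, Int.cast_one, mul_add, mul_one, unip_add]
  | pred k ih =>
    rw [zpow_sub_one, ih, Int.cast_sub, Int.cast_one, mul_sub, mul_one, sub_eq_add_neg, unip_add, unip_neg]

/-- The conjugate unipotent `S_m u_t S_m⁻¹ : (a, b, ·) ↦ (a - (t m²) b, b, ·)` — first component. -/
theorem weylAut_conj_unip_a (t : ℝ) (h : Heis V) :
    ((weylAut m hm * unip t * (weylAut m hm)⁻¹ : MulAut (Heis V)) h).a = h.a - (t * (m : ℝ) ^ 2) • h.b := by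
  have hm' : (m : ℝ) ≠ 0 := Int.cast_ne_zero.mpr hm
  change (weyl m hm (unipFun t (weyl m hm (weyl m hm (weyl m hm h))))).a = _
  rw [weyl_weyl]
  simp only [weyl_a, unipFun_b, weyl_b, weyl_a, smul_neg, neg_neg, smul_add, smul_smul,
    mul_inv_cancel₀ hm', one_smul]
  module

/-- The conjugate unipotent — second component is unchanged. -/
theorem weylAut_conj_unip_b (t : ℝ) (h : Heis V) :
    ((weylAut m hm * unip t * (weylAut m hm)⁻¹ : MulAut (Heis V)) h).b = h.b := by
  have hm' : (m : ℝ) ≠ 0 := Int.cast_ne_zero.mpr hm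
  change (weyl m hm (unipFun t (weyl m hm (weyl m hm (weyl m hm h))))).b = _
  rw [weyl_weyl]
  simp only [weyl_b, unipFun_a, weyl_a, smul_neg, smul_smul, inv_mul_cancel₀ hm', one_smul, neg_neg]

/-- Powers of the conjugate unipotent. -/
theorem weylAut_conj_unip_two_zpow (n : ℤ) :
    (weylAut m hm * unip 2 * (weylAut m hm)⁻¹ : MulAut (Heis V)) ^ n =
      weylAut m hm * unip (2 * (n : ℝ)) * (weylAut m hm)⁻¹ := by
  rw [← unip_two_zpow]
  exact (map_zpow (MulAut.conj (weylAut (V := V) m hm)) (unip 2) n).symm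

/-- The two generators of the ping-pong pair: `true ↦ U = u_2`, `false ↦ S_m U S_m⁻¹`. -/
def pairGen : Bool → MulAut (Heis V)
  | true => unip 2
  | false => weylAut m hm * unip 2 * (weylAut m hm)⁻¹

/-- (Ported verbatim from the HodgeCMPerL package; no docstring in the source.) -/
@[simp] theorem pairGen_true : pairGen (V := V) m hm true = unip 2 := rfl
/-- (Ported verbatim from the HodgeCMPerL package; no docstring in the source.) -/
@[simp] theorem pairGen_false : pairGen (V := V) m hm false = weylAut m hm * unip 2 * (weylAut m hm)⁻¹ := rfl

/-- The ping-pong cones: `true ↦ {‖a‖ < ‖b‖}`, `false ↦ {‖b‖ < ‖a‖}`. -/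
def pairCone : Bool → Set (Heis V)
  | true => {h | ‖h.a‖ < ‖h.b‖}
  | false => {h | ‖h.b‖ < ‖h.a‖}

/-- (Ported verbatim from the HodgeCMPerL package; no docstring in the source.) -/
@[simp] theorem mem_pairCone_true (h : Heis V) : h ∈ pairCone (V := V) true ↔ ‖h.a‖ < ‖h.b‖ := Iff.rfl
/-- (Ported verbatim from the HodgeCMPerL package; no docstring in the source.) -/
@[simp] theorem mem_pairCone_false (h : Heis V) : h ∈ pairCone (V := V) false ↔ ‖h.b‖ < ‖h.a‖ := Iff.rfl

/-- The elementary ping-pong estimate: `‖b‖ < ‖a‖`, `2 ≤ |c|` ⇒ `‖a‖ < ‖b + c • a‖`. -/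
theorem norm_lt_norm_add_smul {a b : V} (hab : ‖b‖ < ‖a‖) {c : ℝ} (hc : 2 ≤ |c|) : ‖a‖ < ‖b + c • a‖ := by
  have h1 : ‖c • a‖ ≤ ‖b + c • a‖ + ‖b‖ := by
    calc ‖c • a‖ = ‖(b + c • a) - b‖ := by rw [add_sub_cancel_left]
      _ ≤ ‖b + c • a‖ + ‖b‖ := norm_sub_le _ _
  rw [norm_smul, Real.norm_eq_abs] at h1
  nlinarith [norm_nonneg a, norm_nonneg b]

/-- (Ported verbatim from the HodgeCMPerL package; no docstring in the source.) -/
theorem pairGen_true_zpow_smul {n : ℤ} (hn : n ≠ 0) :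
    pairGen (V := V) m hm true ^ n • pairCone (V := V) false ⊆ pairCone true := by
  rintro _ ⟨h, hh, rfl⟩
  rw [mem_pairCone_false] at hh
  dsimp only
  rw [pairGen_true, unip_two_zpow, MulAut.smul_def, mem_pairCone_true, unip_apply, unipFun_a, unipFun_b]
  refine norm_lt_norm_add_smul hh ?_
  have : (1 : ℝ) ≤ |(n : ℝ)| := by
    rw [← Int.cast_abs]; exact_mod_cast Int.one_le_abs hn
  rw [abs_mul, abs_two]
  linarith

/-- (Ported verbatim from the HodgeCMPerL package; no docstring in the source.) -/
theorem pairGen_false_zpow_smul {n : ℤ} (hn : n ≠ 0) :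
    pairGen (V := V) m hm false ^ n • pairCone (V := V) true ⊆ pairCone false := by
  rintro _ ⟨h, hh, rfl⟩
  rw [mem_pairCone_true] at hh
  dsimp only
  rw [pairGen_false, weylAut_conj_unip_two_zpow, MulAut.smul_def, mem_pairCone_false, weylAut_conj_unip_a,
    weylAut_conj_unip_b, sub_eq_add_neg, ← neg_smul]
  refine norm_lt_norm_add_smul hh ?_
  have h1 : (1 : ℝ) ≤ |(n : ℝ)| := by
    rw [← Int.cast_abs]; exact_mod_cast Int.one_le_abs hn
  have h2 : (1 : ℝ) ≤ |(m : ℝ)| := by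
    rw [← Int.cast_abs]; exact_mod_cast Int.one_le_abs hm
  rw [abs_neg, abs_mul, abs_mul, abs_two, abs_pow]
  nlinarith

/-- **`U` and `S_m U S_m⁻¹` generate a FREE subgroup of rank two of `Aut (Heis V)`** (any `m ≠ 0`, any
nontrivial `V`). -/
theorem injective_lift_pairGen [Nontrivial V] : Function.Injective (FreeGroup.lift (pairGen (V := V) m hm)) := by
  obtain ⟨v, hv⟩ := exists_ne (0 : V)
  have hv' : ‖(0 : V)‖ < ‖v‖ := by rw [norm_zero]; exact norm_pos_iff.mpr hv
  refine injective_lift_of_zpow_ping_pong (pairGen m hm) (pairCone (V := V)) ?_ ?_ ?_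
  · rintro (_ | _)
    · exact ⟨⟨v, 0, 1⟩, hv'⟩
    · exact ⟨⟨0, v, 1⟩, hv'⟩
  · rintro (_ | _) (_ | _) hij
    · exact (hij rfl).elim
    · exact Set.disjoint_left.mpr fun h (h1 : ‖h.b‖ < ‖h.a‖) (h2 : ‖h.a‖ < ‖h.b‖) => lt_asymm h1 h2
    · exact Set.disjoint_left.mpr fun h (h1 : ‖h.a‖ < ‖h.b‖) (h2 : ‖h.b‖ < ‖h.a‖) => lt_asymm h1 h2
    · exact (hij rfl).elim
  · rintro (_ | _) (_ | _) hij n hn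
    · exact (hij rfl).elim
    · exact pairGen_false_zpow_smul m hm hn
    · exact pairGen_true_zpow_smul m hm hn
    · exact (hij rfl).elim

/-- `S_m, S_m², S_m³ ≠ 1` on a nontrivial `V`: `S_m ^ r = 1` forces `4 ∣ r`. -/
theorem four_dvd_of_weylAut_zpow_eq_one [Nontrivial V] {r : ℤ} (hr : weylAut (V := V) m hm ^ r = 1) : 4 ∣ r := by
  obtain ⟨v, hv⟩ := exists_ne (0 : V)
  have hm' : (m : ℝ) ≠ 0 := Int.cast_ne_zero.mpr hm
  have key : weylAut (V := V) m hm ^ (r % 4) = 1 := by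
    have h4 : weylAut (V := V) m hm ^ (4 : ℤ) = 1 := by exact_mod_cast weylAut_pow_four m hm
    calc weylAut (V := V) m hm ^ (r % 4) = weylAut m hm ^ (r - 4 * (r / 4)) := by rw [Int.emod_def]
      _ = 1 := by rw [zpow_sub, zpow_mul, h4, one_zpow, hr, inv_one, mul_one]
  have hcases : r % 4 = 0 ∨ r % 4 = 1 ∨ r % 4 = 2 ∨ r % 4 = 3 := by omega
  have hv2 : -v ≠ v := fun h => hv (by
    have h2 : (2 : ℝ) • v = 0 := by rw [two_smul]; nth_rw 1 [← h]; exact neg_add_cancel v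
    simpa using h2)
  rcases hcases with h0 | h1 | h2 | h3
  · exact Int.dvd_of_emod_eq_zero h0
  · exfalso
    rw [h1, zpow_one] at key
    have := congrArg (fun f : MulAut (Heis V) => (f ⟨v, 0, 1⟩).a) key
    simp only [weylAut_apply, weyl_a, smul_zero, MulAut.one_apply] at this
    exact hv this.symm
  · exfalso
    rw [h2, show (2 : ℤ) = ((2 : ℕ) : ℤ) from rfl, zpow_natCast] at key
    have := congrArg (fun f : MulAut (Heis V) => (f ⟨v, 0, 1⟩).a) key
    simp only [weylAut_sq_apply, MulAut.one_apply] at this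
    exact hv2 this
  · exfalso
    rw [h3, show (3 : ℤ) = ((2 + 1 : ℕ) : ℤ) from rfl, zpow_natCast, pow_succ] at key
    have := congrArg (fun f : MulAut (Heis V) => (f ⟨v, 0, 1⟩).a) key
    simp only [MulAut.mul_apply, weylAut_apply, weylAut_sq_apply, weyl_a, weyl_b, smul_zero, neg_zero,
      MulAut.one_apply] at this
    exact hv this.symm

end Heis

/-! ## 3. Normal form in `Q = F⟨σ,u⟩ / ⟪σ⁴, [σ², u]⟫` -/

section NormalForm

/-- `F⟨x, y⟩ → F⟨σ, u⟩`, `x ↦ u`, `y ↦ σ u σ⁻¹` (onto the normal closure of `u` modulo the relations). -/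
def toPair : FreeGroup Bool →* FreeGroup PsGen :=
  FreeGroup.lift fun b => cond b (FreeGroup.of PsGen.unip)
    (FreeGroup.of PsGen.weyl * FreeGroup.of PsGen.unip * (FreeGroup.of PsGen.weyl)⁻¹)

/-- (Ported verbatim from the HodgeCMPerL package; no docstring in the source.) -/
@[simp] theorem toPair_of_true : toPair (FreeGroup.of true) = FreeGroup.of PsGen.unip := by
  simp [toPair]

/-- (Ported verbatim from the HodgeCMPerL package; no docstring in the source.) -/
@[simp] theorem toPair_of_false :
    toPair (FreeGroup.of false) = FreeGroup.of PsGen.weyl * FreeGroup.of PsGen.unip * (FreeGroup.of PsGen.weyl)⁻¹ := by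
  simp [toPair]

/-- The swap `x ↔ y` of `F⟨x, y⟩`. -/
def swapPair : FreeGroup Bool →* FreeGroup Bool := FreeGroup.map not

/-- (Ported verbatim from the HodgeCMPerL package; no docstring in the source.) -/
@[simp] theorem swapPair_of (b : Bool) : swapPair (FreeGroup.of b) = FreeGroup.of (!b) := FreeGroup.map.of

/-- (Ported verbatim from the HodgeCMPerL package; no docstring in the source.) -/
instance psRelations_normal : (psRelations).Normal := Subgroup.normalClosure_normal

/-- The quotient `Q = F⟨σ,u⟩ / ⟪σ⁴, [σ², u]⟫`. -/
abbrev PsQuot : Type := FreeGroup PsGen ⧸ psRelations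

/-- The class `s` of `σ` in `Q`. -/
def sQ : PsQuot := QuotientGroup.mk (FreeGroup.of PsGen.weyl)

/-- `Φ : F⟨x, y⟩ → Q`. -/
def ΦQ : FreeGroup Bool →* PsQuot := (QuotientGroup.mk' psRelations).comp toPair

/-- (Ported verbatim from the HodgeCMPerL package; no docstring in the source.) -/
theorem sQ_pow_four : sQ ^ 4 = 1 := by
  rw [sQ, ← QuotientGroup.mk_pow, QuotientGroup.eq_one_iff]
  exact Subgroup.subset_normalClosure (Set.mem_insert _ _)

/-- (Ported verbatim from the HodgeCMPerL package; no docstring in the source.) -/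
theorem sQ_zpow_four : sQ ^ (4 : ℤ) = 1 := by exact_mod_cast sQ_pow_four

/-- The relation `[σ², u] = 1` in `Q`: `s² Φ(x) s⁻² = Φ(x)`. -/
theorem sQ_sq_mul_u : sQ ^ 2 * (QuotientGroup.mk (FreeGroup.of PsGen.unip) : PsQuot) * (sQ ^ 2)⁻¹ =
    QuotientGroup.mk (FreeGroup.of PsGen.unip) := by
  rw [← mul_inv_eq_one, sQ, ← QuotientGroup.mk_pow, ← QuotientGroup.mk_inv, ← QuotientGroup.mk_mul,
    ← QuotientGroup.mk_mul, ← QuotientGroup.mk_inv, ← QuotientGroup.mk_mul, QuotientGroup.eq_one_iff]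
  exact Subgroup.subset_normalClosure (Set.mem_insert_of_mem _ rfl)

/-- Conjugation by `s` swaps the two generators of `Φ(F⟨x, y⟩)`: `s Φ(v) s⁻¹ = Φ(swap v)`. -/
theorem sQ_conj_ΦQ (v : FreeGroup Bool) : sQ * ΦQ v * sQ⁻¹ = ΦQ (swapPair v) := by
  have : ((MulAut.conj sQ).toMonoidHom.comp ΦQ) = ΦQ.comp swapPair := by
    ext b
    cases b
    · simp only [MonoidHom.comp_apply, MulEquiv.coe_toMonoidHom, MulAut.conj_apply, ΦQ, QuotientGroup.coe_mk',
        toPair_of_false, swapPair_of, Bool.not_false, toPair_of_true, QuotientGroup.mk_mul, QuotientGroup.mk_inv]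
      refine Eq.trans ?_ sQ_sq_mul_u
      rw [sQ, pow_two, mul_inv_rev]
      simp only [mul_assoc]
    · simp only [MonoidHom.comp_apply, MulEquiv.coe_toMonoidHom, MulAut.conj_apply, ΦQ, QuotientGroup.coe_mk',
        toPair_of_true, swapPair_of, Bool.not_true, toPair_of_false, QuotientGroup.mk_mul, QuotientGroup.mk_inv, sQ]
  simpa using DFunLike.congr_fun this v

/-- Conjugation by any power of `s` preserves `Φ(F⟨x, y⟩)`. -/
theorem exists_sQ_zpow_conj_ΦQ (k : ℤ) (v : FreeGroup Bool) : ∃ v' : FreeGroup Bool, sQ ^ k * ΦQ v * (sQ ^ k)⁻¹ = ΦQ v' := by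
  induction k using Int.induction_on generalizing v with
  | zero => exact ⟨v, by simp⟩
  | succ k ih =>
    obtain ⟨v', hv'⟩ := ih v
    refine ⟨swapPair v', ?_⟩
    rw [← sQ_conj_ΦQ, ← hv']
    group
  | pred k ih =>
    obtain ⟨v', hv'⟩ := ih v
    refine ⟨swapPair v', ?_⟩
    have h1 : sQ⁻¹ * ΦQ v' * sQ = ΦQ (swapPair v') := by
      have h2 := sQ_conj_ΦQ (swapPair v')
      have h3 : swapPair (swapPair v') = v' := by
        have : swapPair.comp swapPair = MonoidHom.id _ := by ext b; cases b <;> simp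
        simpa using DFunLike.congr_fun this v'
      rw [h3] at h2
      rw [← h2]
      group
    rw [← h1, ← hv']
    group

/-- **Normal form:** every element of `Q` is `s^ε · Φ(v)`. -/
theorem exists_normalForm (w : FreeGroup PsGen) :
    ∃ (ε : ℤ) (v : FreeGroup Bool), (QuotientGroup.mk w : PsQuot) = sQ ^ ε * ΦQ v := by
  induction w using FreeGroup.induction_on with
  | C1 => exact ⟨0, 1, by simp⟩
  | of x =>
    cases x
    · exact ⟨1, 1, by simp [sQ]⟩
    · exact ⟨0, FreeGroup.of true, by simp [ΦQ]⟩
  | inv_of x _ =>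
    cases x
    · exact ⟨-1, 1, by simp [sQ]⟩
    · exact ⟨0, (FreeGroup.of true)⁻¹, by simp [ΦQ]⟩
  | mul x y ihx ihy =>
    obtain ⟨ε₁, v₁, h₁⟩ := ihx
    obtain ⟨ε₂, v₂, h₂⟩ := ihy
    obtain ⟨v₁', h'⟩ := exists_sQ_zpow_conj_ΦQ (-ε₂) v₁
    refine ⟨ε₁ + ε₂, v₁' * v₂, ?_⟩
    rw [QuotientGroup.mk_mul, h₁, h₂, map_mul, ← h']
    group

end NormalForm

/-! ## 4. `ker ψ = ⟪σ⁴, [σ², u]⟫` -/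

namespace Heis

variable {V : Type*} [NormedAddCommGroup V] [InnerProductSpace ℝ V] (m : ℤ) (hm : m ≠ 0)

/-- `⟪σ⁴, [σ², u]⟫ ≤ ker ψ` (restated from #13 for a general universe). -/
theorem psRelations_le_ker_psAction' : psRelations ≤ (psAction (V := V) m hm).ker := by
  refine Subgroup.normalClosure_le_normal ?_
  rintro w (rfl | rfl)
  · exact psAction_weylPowFour m hm
  · exact psAction_commWeylSqUnip m hm

/-- `ψ̄ : Q → Aut (Heis V)`, the descent of `ψ`. -/
def psActionQ : PsQuot →* MulAut (Heis V) :=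
  QuotientGroup.lift psRelations (psAction m hm) (psRelations_le_ker_psAction' m hm)

/-- (Ported verbatim from the HodgeCMPerL package; no docstring in the source.) -/
@[simp] theorem psActionQ_mk (w : FreeGroup PsGen) :
    psActionQ (V := V) m hm (QuotientGroup.mk w) = psAction m hm w := rfl

/-- (Ported verbatim from the HodgeCMPerL package; no docstring in the source.) -/
theorem psActionQ_sQ : psActionQ (V := V) m hm sQ = weylAut m hm := by
  rw [sQ, psActionQ_mk, psAction_weyl]


-- port_pkg: scope closed for this part
end Heis
end SchwartzWeil
end HodgeCM
end
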